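import Literature.Analysis.Distribution.NormalJetPrescription
import Mathlib.LinearAlgebra.Dimension.Finrank
import Mathlib.Topology.Algebra.Module.FiniteDimension
import HarnessLib

/-!
# Normal jets of first-order derivatives of lifted test functions

Topic `Analysis/Distribution`; namespace `Literature.Analysis.Distribution`. Continuation of
`NormalJetCalculus`, `NormalFlatVanishing`, `NormalJetPrescription`: the jet calculus needed to push a
first-order differential equation `D (V h) = μ D h` for a functional `D` carried by `{0} × Z ⊂ B × Z`
down to its top normal jet (Hörmander, Thm. 2.3.5 and §3.1, transposed operators on `Σ ∂^α δ ⊗ u_α`).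

* §1 `fieldDerivC V h = Dh · V` for a vector field `V`; test functions, support, linearity, Leibniz.
* §2 pointwise normal flatness `PtFlat n F z` and the two **diagonal Leibniz formulas** at a flat point:
  `∂_{(b)^n}(g F)(0,z) = g(0,z) ∂_{(b)^n} F(0,z)` if `F` is flat below `n` at `z`, and
  `∂_{(b)^{n+1}}(g F)(0,z) = (n+1) ∂_b g(0,z) ∂_{(b)^n} F(0,z)` if moreover `g(0,z) = 0`.
* §3 **polarization**: symmetric multilinear maps with equal diagonals are equal; flatness from diagonal
  flatness.
* §4 jets of products: `normalJet n (g h) = g(0,·) • normalJet n h` for `h` flat below `n`.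
* §5 the **slot derivation** `slotDeriv L m = Σ_r m ∘_r L` of a `j`-linear map and its diagonal.
* §6 jets of `fieldDerivC W h` for `W` vanishing on the subspace and `h` flat below `n`:
  flat below `n`, and `normalJet n (fieldDerivC W h) z = slotDeriv (normalLinearization W z) (normalJet n h z)`
  with `normalLinearization W z b = (DW(0,z)(b,0)).1`.

Everything is proved; no named fact is introduced.

## References

* L. Hörmander, *The Analysis of Linear Partial Differential Operators I* (1983), Thm. 2.3.5, §3.1
  [HormanderALPDO1].
-/

noncomputable section

open Set Filter Topology Function Metric
open scoped ContDiff

namespace Literature.Analysis.Distribution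

variable {X : Type*} [NormedAddCommGroup X] [NormedSpace ℝ X]
variable {B Z : Type*} [NormedAddCommGroup B] [NormedSpace ℝ B] [NormedAddCommGroup Z] [NormedSpace ℝ Z]

/-! ### 1. Derivative along a vector field -/

section Field

/-- **The derivative of `h` along the vector field `V`**: `fieldDerivC V h x = Dh(x) (V x)`. [folklore] -/
def fieldDerivC (V : X → X) (h : X → ℂ) (x : X) : ℂ := fderiv ℝ h x (V x)

/-- `fieldDerivC V h x = ∂_{V x} h (x)`. [folklore] -/
theorem fieldDerivC_apply (V : X → X) (h : X → ℂ) (x : X) : fieldDerivC V h x = vecDeriv (V x) h x := rfl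

/-- `fieldDerivC` along a smooth field of a smooth function is smooth. [folklore] -/
theorem contDiff_fieldDerivC {V : X → X} (hV : ContDiff ℝ ∞ V) {h : X → ℂ} (hh : ContDiff ℝ ∞ h) :
    ContDiff ℝ ∞ (fieldDerivC V h) :=
  (hh.fderiv_right (m := ∞) (by norm_cast)).clm_apply hV

/-- The support of `fieldDerivC V h` lies in that of `h`. [folklore] -/
theorem tsupport_fieldDerivC_subset (V : X → X) (h : X → ℂ) : tsupport (fieldDerivC V h) ⊆ tsupport h := by
  refine closure_minimal (fun x hx => ?_) (isClosed_tsupport h)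
  by_contra hxt
  apply hx
  have h0 : fderiv ℝ h x = 0 := by
    have : x ∉ Function.support (fderiv ℝ h) := fun hm => hxt (support_fderiv_subset ℝ hm)
    simpa [Function.mem_support] using this
  simp [fieldDerivC, h0]

/-- `fieldDerivC` of a test function along a smooth field is a test function. [folklore] -/
theorem IsTestFn.fieldDerivC {V : X → X} (hV : ContDiff ℝ ∞ V) {h : X → ℂ} (hh : IsTestFn h) : IsTestFn (fieldDerivC V h) :=
  ⟨contDiff_fieldDerivC hV hh.contDiff,
    IsCompact.of_isClosed_subset hh.hasCompactSupport (isClosed_tsupport _) (tsupport_fieldDerivC_subset V h)⟩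

/-- `fieldDerivC` is additive in `h`. [folklore] -/
theorem fieldDerivC_add {V : X → X} {f g : X → ℂ} (hf : Differentiable ℝ f) (hg : Differentiable ℝ g) :
    fieldDerivC V (f + g) = fieldDerivC V f + fieldDerivC V g := by
  funext x
  simp only [fieldDerivC, Pi.add_apply, fderiv_add (hf x) (hg x), add_apply]

/-- `fieldDerivC` is homogeneous in `h`. [folklore] -/
theorem fieldDerivC_smul {V : X → X} (c : ℂ) (f : X → ℂ) : fieldDerivC V (c • f) = c • fieldDerivC V f := by
  funext x
  exact congrArg (fun F : X → ℂ => F x) (vecDeriv_smul c f (V x)) ▸ rfl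

/-- `fieldDerivC` of a finite sum of differentiable functions. [folklore] -/
theorem fieldDerivC_finset_sum {V : X → X} {ι : Type*} (s : Finset ι) {f : ι → X → ℂ} (hf : ∀ i ∈ s, Differentiable ℝ (f i)) :
    fieldDerivC V (∑ i ∈ s, f i) = ∑ i ∈ s, fieldDerivC V (f i) := by
  funext x
  rw [Finset.sum_apply, fieldDerivC, fderiv_sum fun i hi => hf i hi x, sum_apply]
  rfl

/-- **Leibniz rule** `V(g h) = g · V h + (V g) · h`. [folklore] -/
theorem fieldDerivC_mul {V : X → X} {g h : X → ℂ} (hg : Differentiable ℝ g) (hh : Differentiable ℝ h) :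
    fieldDerivC V (g * h) = g * fieldDerivC V h + fieldDerivC V g * h := by
  funext x
  have := congrArg (fun F : X → ℂ => F x) (vecDeriv_mul hg hh (V x))
  simp only [Pi.add_apply, Pi.mul_apply] at this
  simp only [Pi.add_apply, Pi.mul_apply, fieldDerivC_apply]
  rw [this]
  ring

/-- `fieldDerivC` is additive in the field. [folklore] -/
theorem fieldDerivC_add_field (V V' : X → X) (h : X → ℂ) : fieldDerivC (V + V') h = fieldDerivC V h + fieldDerivC V' h := by
  funext x; simp [fieldDerivC]

/-- `fieldDerivC` along `c • V` for a real function `c`. [folklore] -/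
theorem fieldDerivC_smul_field (c : X → ℝ) (V : X → X) (h : X → ℂ) :
    fieldDerivC (fun x => c x • V x) h = fun x => (c x : ℂ) * fieldDerivC V h x := by
  funext x; simp [fieldDerivC, Complex.real_smul]

/-- `fieldDerivC` along a finite sum of fields. [folklore] -/
theorem fieldDerivC_finset_sum_field {ι : Type*} (s : Finset ι) (V : ι → X → X) (h : X → ℂ) :
    fieldDerivC (fun x => ∑ i ∈ s, V i x) h = fun x => ∑ i ∈ s, fieldDerivC (V i) h x := by
  funext x; simp [fieldDerivC, map_sum]

/-- Off the support of `h`, `fieldDerivC V h` only depends on... nothing: it vanishes; so the field may be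
modified off `tsupport h`. [folklore] -/
theorem fieldDerivC_congr_of_eqOn {V V' : X → X} {h : X → ℂ} (hVV' : ∀ x ∈ tsupport h, V x = V' x) :
    fieldDerivC V h = fieldDerivC V' h := by
  funext x
  by_cases hx : x ∈ tsupport h
  · rw [fieldDerivC, fieldDerivC, hVV' x hx]
  · have h1 : x ∉ tsupport (fieldDerivC V h) := fun hm => hx (tsupport_fieldDerivC_subset V h hm)
    have h2 : x ∉ tsupport (fieldDerivC V' h) := fun hm => hx (tsupport_fieldDerivC_subset V' h hm)
    rw [image_eq_zero_of_notMem_tsupport h1, image_eq_zero_of_notMem_tsupport h2]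

end Field

/-! ### 2. Pointwise normal flatness and the diagonal Leibniz formulas -/

section PtFlat

/-- **Pointwise normal flatness**: all normal word derivatives of length `< n` of `F` vanish at `(0, z)`.
[folklore] -/
def PtFlat (n : ℕ) (F : B × Z → ℂ) (z : Z) : Prop :=
  ∀ u : List B, u.length < n → vecWordDeriv (normalWord u) F ((0 : B), z) = 0

/-- `NormalJetsVanishBelow n F ↔ ∀ z, PtFlat n F z`. [folklore] -/
theorem normalJetsVanishBelow_iff_ptFlat (n : ℕ) (F : B × Z → ℂ) : NormalJetsVanishBelow n F ↔ ∀ z, PtFlat n F z :=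
  ⟨fun h z u hu => h u hu z, fun h u hu z => h z u hu⟩

/-- Monotonicity of `PtFlat`. [folklore] -/
theorem PtFlat.mono {n n' : ℕ} {F : B × Z → ℂ} {z : Z} (h : PtFlat n F z) (hn : n' ≤ n) : PtFlat n' F z :=
  fun u hu => h u (lt_of_lt_of_le hu hn)

/-- A normal derivative costs one order of pointwise flatness. [folklore] -/
theorem PtFlat.vecDeriv_inl {n : ℕ} {F : B × Z → ℂ} {z : Z} (h : PtFlat n F z) (b : B) :
    PtFlat (n - 1) (vecDeriv ((b, 0) : B × Z) F) z := by
  intro u hu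
  rw [← vecWordDeriv_append_singleton, show normalWord u ++ [((b, 0) : B × Z)] = normalWord (u ++ [b]) by
    rw [normalWord_append]; rfl]
  exact h _ (by simp; omega)

/-- `PtFlat` is additive. [folklore] -/
theorem PtFlat.add {n : ℕ} {F G : B × Z → ℂ} {z : Z} (hFs : ContDiff ℝ ∞ F) (hGs : ContDiff ℝ ∞ G)
    (hF : PtFlat n F z) (hG : PtFlat n G z) : PtFlat n (F + G) z := by
  intro u hu
  rw [vecWordDeriv_add' hFs hGs, Pi.add_apply, hF u hu, hG u hu, add_zero]

/-- `PtFlat` of a finite sum. [folklore] -/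
theorem PtFlat.finset_sum {n : ℕ} {ι : Type*} (s : Finset ι) {F : ι → B × Z → ℂ} {z : Z}
    (hFs : ∀ i ∈ s, ContDiff ℝ ∞ (F i)) (hF : ∀ i ∈ s, PtFlat n (F i) z) : PtFlat n (∑ i ∈ s, F i) z := by
  classical
  induction s using Finset.induction_on with
  | empty =>
    intro u hu
    rw [Finset.sum_empty]
    induction u with
    | nil => rfl
    | cons a u ih =>
      have : vecWordDeriv (normalWord (Z := Z) (a :: u)) (0 : B × Z → ℂ) = 0 := by
        clear ih hu
        induction (normalWord (Z := Z) (a :: u)) with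
        | nil => rfl
        | cons c w ih2 => rw [vecWordDeriv_cons, ih2]; funext x; simp [vecDeriv]
      rw [this]; rfl
  | insert a s ha ih =>
    rw [Finset.sum_insert ha]
    have hs : ContDiff ℝ ∞ (∑ i ∈ s, F i) := by
      rw [Finset.sum_fn]; exact ContDiff.sum fun i hi => hFs i (Finset.mem_insert_of_mem hi)
    exact PtFlat.add (hFs a (Finset.mem_insert_self a s)) hs
      (hF a (Finset.mem_insert_self a s)) (ih (fun i hi => hFs i (Finset.mem_insert_of_mem hi)) fun i hi => hF i (Finset.mem_insert_of_mem hi))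

/-- A function vanishing near `(0, z)` is pointwise flat there to all orders. [folklore] -/
theorem ptFlat_of_notMem_tsupport {F : B × Z → ℂ} {z : Z} (hz : ((0 : B), z) ∉ tsupport F) (n : ℕ) : PtFlat n F z := by
  intro u _
  exact image_eq_zero_of_notMem_tsupport fun hm => hz (tsupport_vecWordDeriv_subset F _ hm)

/-- One normal derivative more on a diagonal word. [folklore] -/
theorem vecWordDeriv_normalWord_replicate_succ (n : ℕ) (b : B) (F : B × Z → ℂ) :
    vecWordDeriv (normalWord (Z := Z) (List.replicate (n + 1) b)) F =
      vecWordDeriv (normalWord (Z := Z) (List.replicate n b)) (vecDeriv ((b, 0) : B × Z) F) := by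
  rw [List.replicate_succ', normalWord_append, show normalWord (Z := Z) [b] = [((b, 0) : B × Z)] from rfl,
    vecWordDeriv_append_singleton]

/-- **Diagonal Leibniz formula at a flat point, I**: if `F` is flat below order `n` at `z` then
`∂_{(b,0)^n}(g F)(0,z) = g(0,z) ∂_{(b,0)^n} F(0,z)`. [folklore] -/
theorem vecWordDeriv_mul_of_ptFlat :
    ∀ (n : ℕ) {g F : B × Z → ℂ}, ContDiff ℝ ∞ g → ContDiff ℝ ∞ F → ∀ {z : Z}, PtFlat n F z → ∀ b : B,
      vecWordDeriv (normalWord (List.replicate n b)) (g * F) ((0 : B), z) =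
        g ((0 : B), z) * vecWordDeriv (normalWord (List.replicate n b)) F ((0 : B), z)
  | 0, g, F, _, _, z, _, b => by simp
  | n + 1, g, F, hg, hF, z, hflat, b => by
    have h1 : ContDiff ℝ ∞ (vecDeriv ((b, 0) : B × Z) g * F) := (hg.vecDeriv' _).mul hF
    have h2 : ContDiff ℝ ∞ (g * vecDeriv ((b, 0) : B × Z) F) := hg.mul (hF.vecDeriv' _)
    rw [vecWordDeriv_normalWord_replicate_succ, vecWordDeriv_normalWord_replicate_succ,
      vecDeriv_mul (hg.differentiable (by simp)) (hF.differentiable (by simp)),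
      vecWordDeriv_add' h1 h2, Pi.add_apply,
      vecWordDeriv_mul_of_ptFlat n (hg.vecDeriv' _) hF (hflat.mono (Nat.le_succ n)) b,
      vecWordDeriv_mul_of_ptFlat n hg (hF.vecDeriv' _) (by simpa using hflat.vecDeriv_inl b) b]
    have h0 : vecWordDeriv (normalWord (List.replicate n b)) F ((0 : B), z) = 0 := hflat _ (by simp)
    rw [h0, mul_zero, zero_add]

/-- **Diagonal Leibniz formula at a flat point, II**: if `F` is flat below order `n` at `z` and `g(0,z) = 0`
then `∂_{(b,0)^{n+1}}(g F)(0,z) = (n+1) ∂_{(b,0)} g(0,z) ∂_{(b,0)^n} F(0,z)`. [folklore] -/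
theorem vecWordDeriv_mul_of_ptFlat_of_eq_zero :
    ∀ (n : ℕ) {g F : B × Z → ℂ}, ContDiff ℝ ∞ g → ContDiff ℝ ∞ F → ∀ {z : Z}, g ((0 : B), z) = 0 → PtFlat n F z →
      ∀ b : B, vecWordDeriv (normalWord (List.replicate (n + 1) b)) (g * F) ((0 : B), z) =
        ((n + 1 : ℕ) : ℂ) * vecDeriv ((b, 0) : B × Z) g ((0 : B), z) *
          vecWordDeriv (normalWord (List.replicate n b)) F ((0 : B), z)
  | 0, g, F, hg, hF, z, hg0, _, b => by
    rw [vecWordDeriv_normalWord_replicate_succ]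
    simp only [List.replicate_zero, normalWord_nil, vecWordDeriv_nil]
    rw [vecDeriv_mul (hg.differentiable (by simp)) (hF.differentiable (by simp))]
    simp [hg0]
  | n + 1, g, F, hg, hF, z, hg0, hflat, b => by
    have h1 : ContDiff ℝ ∞ (vecDeriv ((b, 0) : B × Z) g * F) := (hg.vecDeriv' _).mul hF
    have h2 : ContDiff ℝ ∞ (g * vecDeriv ((b, 0) : B × Z) F) := hg.mul (hF.vecDeriv' _)
    rw [vecWordDeriv_normalWord_replicate_succ (n + 1),
      vecDeriv_mul (hg.differentiable (by simp)) (hF.differentiable (by simp)),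
      vecWordDeriv_add' h1 h2, Pi.add_apply,
      vecWordDeriv_mul_of_ptFlat (n + 1) (hg.vecDeriv' _) hF hflat b,
      vecWordDeriv_mul_of_ptFlat_of_eq_zero n hg (hF.vecDeriv' _) hg0 (by simpa using hflat.vecDeriv_inl b) b,
      ← vecWordDeriv_normalWord_replicate_succ]
    push_cast
    ring

end PtFlat

/-! ### 3. Polarization -/

section Polar

/-- **Polarization**: a symmetric `j`-linear map is determined by its diagonal,
`m v = (j!)⁻¹ D^j (diagFn m)(0)(v)`. [folklore] -/
theorem apply_eq_iteratedFDeriv_diagFn {j : ℕ} {m : NormalJetSpace B j}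
    (hm : ∀ (v : Fin j → B) (σ : Equiv.Perm (Fin j)), m (v ∘ σ) = m v) (v : Fin j → B) :
    m v = ((Nat.factorial j : ℂ)⁻¹) * iteratedFDeriv ℝ j (diagFn m) 0 v := by
  rw [iteratedFDeriv_diagFn_self, symmetrize_eq_self_of_forall_comp_perm hm, ← mul_assoc,
    inv_mul_cancel₀ (by exact_mod_cast (Nat.factorial_pos j).ne'), one_mul]

/-- **Symmetric multilinear maps with equal diagonals are equal.** [folklore] -/
theorem eq_of_forall_diag_eq {j : ℕ} {m m' : NormalJetSpace B j}
    (hm : ∀ (v : Fin j → B) (σ : Equiv.Perm (Fin j)), m (v ∘ σ) = m v)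
    (hm' : ∀ (v : Fin j → B) (σ : Equiv.Perm (Fin j)), m' (v ∘ σ) = m' v)
    (h : ∀ b : B, m (fun _ => b) = m' (fun _ => b)) : m = m' := by
  have hd : diagFn m = diagFn m' := funext h
  ext v
  rw [apply_eq_iteratedFDeriv_diagFn hm, apply_eq_iteratedFDeriv_diagFn hm', hd]

/-- The diagonal values of a normal jet are diagonal word derivatives. [folklore] -/
theorem normalJet_apply_const {h : B × Z → ℂ} (hh : ContDiff ℝ ∞ h) (i : ℕ) (z : Z) (b : B) :
    normalJet i h z (fun _ => b) = vecWordDeriv (normalWord (List.replicate i b)) h ((0 : B), z) := by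
  rw [← vecWordDeriv_normalWord_ofFn_eq_normalJet hh, List.ofFn_const]

/-- **Flatness from diagonal flatness** (polarization order by order). [folklore] -/
theorem PtFlat.of_diag {n : ℕ} {F : B × Z → ℂ} (hF : ContDiff ℝ ∞ F) {z : Z}
    (h : ∀ i < n, ∀ b : B, vecWordDeriv (normalWord (List.replicate i b)) F ((0 : B), z) = 0) : PtFlat n F z := by
  intro u hu
  have hjet : normalJet u.length F z = 0 := by
    refine eq_of_forall_diag_eq (fun v σ => normalJet_comp_perm hF z v σ) (fun v σ => by simp) fun b => ?_
    rw [normalJet_apply_const hF, h _ hu b, zero_apply]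
  have h1 := vecWordDeriv_normalWord_ofFn_eq_normalJet hF (fun i => u.get i) z
  rw [List.ofFn_get] at h1
  rw [h1, hjet, zero_apply]

end Polar

/-! ### 4. Jets of products with a flat factor -/

section MulFlat

/-- Products with a factor flat below `n` at `z` are flat below `n` at `z`. [folklore] -/
theorem PtFlat.mul_left {n : ℕ} {g h : B × Z → ℂ} (hg : ContDiff ℝ ∞ g) (hh : ContDiff ℝ ∞ h) {z : Z}
    (hflat : PtFlat n h z) : PtFlat n (g * h) z := by
  have hgh : ContDiff ℝ ∞ (g * h) := hg.mul hh
  exact PtFlat.of_diag hgh fun i hi b => by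
    rw [vecWordDeriv_mul_of_ptFlat i hg hh (hflat.mono hi.le) b, hflat _ (by simpa using hi), mul_zero]

/-- Products with a factor flat below `n` are flat below `n`. [folklore] -/
theorem NormalJetsVanishBelow.mul_left {n : ℕ} {g h : B × Z → ℂ} (hg : ContDiff ℝ ∞ g) (hh : ContDiff ℝ ∞ h)
    (hflat : NormalJetsVanishBelow n h) : NormalJetsVanishBelow n (g * h) := by
  rw [normalJetsVanishBelow_iff_ptFlat] at hflat ⊢
  exact fun z => (hflat z).mul_left hg hh

/-- **Top jet of a product with a flat factor**: `normalJet n (g h) z = g(0,z) • normalJet n h z` when `h` is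
flat below `n` at `z`. [folklore] -/
theorem normalJet_mul_of_ptFlat {n : ℕ} {g h : B × Z → ℂ} (hg : ContDiff ℝ ∞ g) (hh : ContDiff ℝ ∞ h) {z : Z}
    (hflat : PtFlat n h z) : normalJet n (g * h) z = g ((0 : B), z) • normalJet n h z := by
  have hgh : ContDiff ℝ ∞ (g * h) := hg.mul hh
  refine eq_of_forall_diag_eq (fun v σ => normalJet_comp_perm hgh z v σ)
    (fun v σ => by rw [smul_apply, smul_apply, normalJet_comp_perm hh]) fun b => ?_
  rw [normalJet_apply_const hgh, smul_apply, normalJet_apply_const hh, vecWordDeriv_mul_of_ptFlat n hg hh hflat b,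
    smul_eq_mul]

end MulFlat

/-! ### 5. The slot derivation of a multilinear map -/

section Slot

/-- `L` in slot `r`, the identity elsewhere. [folklore] -/
def slotMap {j : ℕ} (r : Fin j) (L : B →L[ℝ] B) (i : Fin j) : B →L[ℝ] B :=
  if i = r then L else ContinuousLinearMap.id ℝ B

/-- **The slot derivation** `slotDeriv L m = Σ_r m ∘ (L in slot r)`: the action of the linear vector field
`L` on `j`-linear maps. [folklore] -/
def slotDeriv {j : ℕ} (L : B →L[ℝ] B) (m : NormalJetSpace B j) : NormalJetSpace B j :=
  ∑ r : Fin j, m.compContinuousLinearMap (slotMap r L)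

/-- `slotDeriv L m v = Σ_r m (v with v_r replaced by L v_r)`. [folklore] -/
theorem slotDeriv_apply {j : ℕ} (L : B →L[ℝ] B) (m : NormalJetSpace B j) (v : Fin j → B) :
    slotDeriv L m v = ∑ r : Fin j, m (update v r (L (v r))) := by
  rw [slotDeriv, sum_apply]
  refine Finset.sum_congr rfl fun r _ => ?_
  rw [ContinuousMultilinearMap.compContinuousLinearMap_apply]
  congr 1
  funext i
  by_cases hir : i = r
  · subst hir; simp [slotMap]
  · simp [slotMap, hir]

/-- `slotDeriv L` is additive. [folklore] -/
theorem slotDeriv_add {j : ℕ} (L : B →L[ℝ] B) (m m' : NormalJetSpace B j) :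
    slotDeriv L (m + m') = slotDeriv L m + slotDeriv L m' := by
  ext v; simp [slotDeriv_apply, Finset.sum_add_distrib]

/-- `slotDeriv L` is homogeneous. [folklore] -/
theorem slotDeriv_smul {j : ℕ} (L : B →L[ℝ] B) (c : ℂ) (m : NormalJetSpace B j) :
    slotDeriv L (c • m) = c • slotDeriv L m := by
  ext v; simp [slotDeriv_apply, Finset.mul_sum]

/-- `slotDeriv` is additive in `L`. [folklore] -/
theorem slotDeriv_add_left {j : ℕ} (L L' : B →L[ℝ] B) (m : NormalJetSpace B j) :
    slotDeriv (L + L') m = slotDeriv L m + slotDeriv L' m := by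
  ext v
  simp only [slotDeriv_apply, add_apply, ← Finset.sum_add_distrib]
  refine Finset.sum_congr rfl fun r _ => ?_
  rw [← ContinuousMultilinearMap.map_update_add]

/-- `slotDeriv` is homogeneous in `L` (real scalars). [folklore] -/
theorem slotDeriv_smul_left {j : ℕ} (c : ℝ) (L : B →L[ℝ] B) (m : NormalJetSpace B j) :
    slotDeriv (c • L) m = c • slotDeriv L m := by
  ext v
  simp only [slotDeriv_apply, smul_apply, Finset.smul_sum]
  refine Finset.sum_congr rfl fun r _ => ?_
  rw [← ContinuousMultilinearMap.map_update_smul]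

/-- **`slotDeriv L` preserves symmetry.** [folklore] -/
theorem slotDeriv_comp_perm {j : ℕ} (L : B →L[ℝ] B) {m : NormalJetSpace B j}
    (hm : ∀ (v : Fin j → B) (σ : Equiv.Perm (Fin j)), m (v ∘ σ) = m v) (v : Fin j → B) (σ : Equiv.Perm (Fin j)) :
    slotDeriv L m (v ∘ σ) = slotDeriv L m v := by
  rw [slotDeriv_apply, slotDeriv_apply]
  have h1 : ∀ r : Fin j, m (update (v ∘ σ) r (L ((v ∘ σ) r))) = m (update v (σ r) (L (v (σ r)))) := fun r => by
    have : update (v ∘ σ) r (L ((v ∘ σ) r)) = update v (σ r) (L (v (σ r))) ∘ σ := by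
      rw [update_comp_equiv]; simp
    rw [this, hm]
  simp_rw [h1]
  exact Equiv.sum_comp σ (fun r => m (update v r (L (v r))))

/-- **The slot derivation on the diagonal** of a symmetric map:
`slotDeriv L m (b, …, b) = j · m(b, …, b, L b)`. [folklore] -/
theorem slotDeriv_apply_const {j : ℕ} (L : B →L[ℝ] B) {m : NormalJetSpace B (j + 1)}
    (hm : ∀ (v : Fin (j + 1) → B) (σ : Equiv.Perm (Fin (j + 1))), m (v ∘ σ) = m v) (b : B) :
    slotDeriv L m (fun _ => b) = ((j + 1 : ℕ) : ℂ) * m (update (fun _ => b) (Fin.last j) (L b)) := by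
  rw [slotDeriv_apply]
  have h1 : ∀ r : Fin (j + 1), m (update (fun _ : Fin (j + 1) => b) r (L b)) =
      m (update (fun _ : Fin (j + 1) => b) (Fin.last j) (L b)) := fun r => by
    have h := hm (update (fun _ : Fin (j + 1) => b) (Fin.last j) (L b)) (Equiv.swap r (Fin.last j))
    rw [update_comp_equiv] at h
    simpa [Equiv.symm_swap, Equiv.swap_apply_right, Function.comp_def] using h
  simp_rw [h1]
  rw [Finset.sum_const, Finset.card_univ, Fintype.card_fin, nsmul_eq_mul]

end Slot

/-! ### 6. Jets of the derivative along a field vanishing on the subspace -/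

section FieldJet

variable [FiniteDimensional ℝ B] [FiniteDimensional ℝ Z]

/-- `B`-coordinates of a vector field on `B × Z` in the basis `Module.finBasis ℝ B`. [folklore] -/
def fieldCoefB (W : B × Z → B × Z) (i : Fin (Module.finrank ℝ B)) (x : B × Z) : ℝ :=
  (Module.finBasis ℝ B).repr (W x).1 i

/-- `Z`-coordinates of a vector field on `B × Z` in the basis `Module.finBasis ℝ Z`. [folklore] -/
def fieldCoefZ (W : B × Z → B × Z) (k : Fin (Module.finrank ℝ Z)) (x : B × Z) : ℝ :=
  (Module.finBasis ℝ Z).repr (W x).2 k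

omit [FiniteDimensional ℝ Z] in
/-- The coordinates of a smooth field are smooth. [folklore] -/
theorem contDiff_fieldCoefB {W : B × Z → B × Z} (hW : ContDiff ℝ ∞ W) (i : Fin (Module.finrank ℝ B)) :
    ContDiff ℝ ∞ (fieldCoefB W i) := by
  have h1 : fieldCoefB W i = fun x => LinearMap.toContinuousLinearMap ((Module.finBasis ℝ B).coord i) (W x).1 := by
    funext x; simp [fieldCoefB]
  rw [h1]
  exact (LinearMap.toContinuousLinearMap ((Module.finBasis ℝ B).coord i)).contDiff.comp (contDiff_fst.comp hW)

omit [FiniteDimensional ℝ B] in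
/-- The coordinates of a smooth field are smooth. [folklore] -/
theorem contDiff_fieldCoefZ {W : B × Z → B × Z} (hW : ContDiff ℝ ∞ W) (k : Fin (Module.finrank ℝ Z)) :
    ContDiff ℝ ∞ (fieldCoefZ W k) := by
  have h1 : fieldCoefZ W k = fun x => LinearMap.toContinuousLinearMap ((Module.finBasis ℝ Z).coord k) (W x).2 := by
    funext x; simp [fieldCoefZ]
  rw [h1]
  exact (LinearMap.toContinuousLinearMap ((Module.finBasis ℝ Z).coord k)).contDiff.comp (contDiff_snd.comp hW)

/-- Expansion of a field in the product basis. [folklore] -/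
theorem field_eq_sum (W : B × Z → B × Z) (x : B × Z) :
    W x = ∑ i, fieldCoefB W i x • (((Module.finBasis ℝ B) i, 0) : B × Z) +
      ∑ k, fieldCoefZ W k x • (((0 : B), (Module.finBasis ℝ Z) k) : B × Z) := by
  ext
  · simp [Prod.fst_sum, fieldCoefB, (Module.finBasis ℝ B).sum_repr]
  · simp [Prod.snd_sum, fieldCoefZ, (Module.finBasis ℝ Z).sum_repr]

omit [NormedSpace ℝ Z] [FiniteDimensional ℝ Z] in
/-- The coordinates vanish where the field vanishes. [folklore] -/
theorem fieldCoefB_eq_zero {W : B × Z → B × Z} {x : B × Z} (hx : W x = 0) (i : Fin (Module.finrank ℝ B)) :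
    fieldCoefB W i x = 0 := by simp [fieldCoefB, hx]

omit [NormedSpace ℝ B] [FiniteDimensional ℝ B] in
/-- The coordinates vanish where the field vanishes. [folklore] -/
theorem fieldCoefZ_eq_zero {W : B × Z → B × Z} {x : B × Z} (hx : W x = 0) (k : Fin (Module.finrank ℝ Z)) :
    fieldCoefZ W k x = 0 := by simp [fieldCoefZ, hx]

/-- **Expansion of `fieldDerivC W h` in the product basis**:
`W h = Σ_i c_i ∂_{(e_i,0)} h + Σ_k d_k ∂_{(0,f_k)} h`. [folklore] -/
theorem fieldDerivC_eq_sum (W : B × Z → B × Z) (h : B × Z → ℂ) :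
    fieldDerivC W h =
      ∑ i, (fun x => (fieldCoefB W i x : ℂ) * vecDeriv (((Module.finBasis ℝ B) i, 0) : B × Z) h x) +
        ∑ k, (fun x => (fieldCoefZ W k x : ℂ) * vecDeriv (((0 : B), (Module.finBasis ℝ Z) k) : B × Z) h x) := by
  funext x
  rw [fieldDerivC, field_eq_sum W x, map_add, map_sum, map_sum]
  simp only [Finset.sum_apply, Pi.add_apply, map_smul, vecDeriv, Complex.real_smul]

/-- `∂_w 0 = 0`. [folklore] -/
theorem vecWordDeriv_zero : ∀ w : List X, vecWordDeriv w (0 : X → ℂ) = 0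
  | [] => rfl
  | a :: w => by
    rw [vecWordDeriv_cons, vecWordDeriv_zero w]
    funext x; simp [vecDeriv]

/-- `∂_w` of a finite sum of smooth functions. [folklore] -/
theorem vecWordDeriv_finset_sum {ι : Type*} (s : Finset ι) {f : ι → X → ℂ} (hf : ∀ i ∈ s, ContDiff ℝ ∞ (f i)) (w : List X) :
    vecWordDeriv w (∑ i ∈ s, f i) = ∑ i ∈ s, vecWordDeriv w (f i) := by
  classical
  induction s using Finset.induction_on with
  | empty => simp [vecWordDeriv_zero]
  | insert a s ha ih =>
    have hs : ContDiff ℝ ∞ (∑ i ∈ s, f i) := by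
      rw [Finset.sum_fn]; exact ContDiff.sum fun i hi => hf i (Finset.mem_insert_of_mem hi)
    rw [Finset.sum_insert ha, Finset.sum_insert ha, vecWordDeriv_add' (hf a (Finset.mem_insert_self a s)) hs,
      ih fun i hi => hf i (Finset.mem_insert_of_mem hi)]

omit [FiniteDimensional ℝ B] [FiniteDimensional ℝ Z] in
/-- A tangential derivative of a function flat below `n` is flat below `n`. [folklore] -/
theorem NormalJetsVanishBelow.vecDeriv_inr {n : ℕ} {h : B × Z → ℂ} (hh : ContDiff ℝ ∞ h) (hflat : NormalJetsVanishBelow n h)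
    (ζ : Z) : NormalJetsVanishBelow n (Distribution.vecDeriv ((0 : B), ζ) h) := by
  intro u hu z
  rw [vecWordDeriv_vecDeriv' hh]
  exact vecDeriv_inr_eq_zero_of_forall_eq_zero ((hh.vecWordDeriv' _).differentiable (by simp)) (fun z' => hflat u hu z') ζ z

omit [FiniteDimensional ℝ B] [FiniteDimensional ℝ Z] in
/-- `∂_v` of a real function cast to `ℂ`. [folklore] -/
theorem vecDeriv_ofReal_comp {c : B × Z → ℝ} (hc : Differentiable ℝ c) (v x : B × Z) :
    vecDeriv v (fun y => (c y : ℂ)) x = ((fderiv ℝ c x v : ℝ) : ℂ) := by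
  rw [vecDeriv, show (fun y => (c y : ℂ)) = Complex.ofRealCLM ∘ c from rfl,
    (Complex.ofRealCLM.hasFDerivAt.comp x (hc x).hasFDerivAt).fderiv]
  rfl

/-- **`fieldDerivC W h` is flat below `n` at `z`** if `h` is flat below `n` and `W(0,z) = 0`. [folklore] -/
theorem ptFlat_fieldDerivC {W : B × Z → B × Z} (hW : ContDiff ℝ ∞ W) {h : B × Z → ℂ} (hh : ContDiff ℝ ∞ h) {n : ℕ}
    (hflat : NormalJetsVanishBelow n h) {z : Z} (hW0 : W ((0 : B), z) = 0) : PtFlat n (fieldDerivC W h) z := by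
  have hG : ∀ i, ContDiff ℝ ∞ fun x => (fieldCoefB W i x : ℂ) * vecDeriv (((Module.finBasis ℝ B) i, 0) : B × Z) h x :=
    fun i => (Complex.ofRealCLM.contDiff.comp (contDiff_fieldCoefB hW i)).mul (hh.vecDeriv' _)
  have hH : ∀ k, ContDiff ℝ ∞ fun x => (fieldCoefZ W k x : ℂ) * vecDeriv (((0 : B), (Module.finBasis ℝ Z) k) : B × Z) h x :=
    fun k => (Complex.ofRealCLM.contDiff.comp (contDiff_fieldCoefZ hW k)).mul (hh.vecDeriv' _)
  have hsumG : ContDiff ℝ ∞ (∑ i, fun x => (fieldCoefB W i x : ℂ) * vecDeriv (((Module.finBasis ℝ B) i, 0) : B × Z) h x) := by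
    rw [Finset.sum_fn]; exact ContDiff.sum fun i _ => hG i
  have hsumH : ContDiff ℝ ∞ (∑ k, fun x => (fieldCoefZ W k x : ℂ) * vecDeriv (((0 : B), (Module.finBasis ℝ Z) k) : B × Z) h x) := by
    rw [Finset.sum_fn]; exact ContDiff.sum fun k _ => hH k
  rw [fieldDerivC_eq_sum]
  refine PtFlat.add hsumG hsumH (PtFlat.finset_sum _ (fun i _ => hG i) fun i _ => ?_)
    (PtFlat.finset_sum _ (fun k _ => hH k) fun k _ => ?_)
  · -- normal terms
    have hcs : ContDiff ℝ ∞ fun x => (fieldCoefB W i x : ℂ) := Complex.ofRealCLM.contDiff.comp (contDiff_fieldCoefB hW i)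
    have hGs : ContDiff ℝ ∞ (vecDeriv (((Module.finBasis ℝ B) i, 0) : B × Z) h) := hh.vecDeriv' _
    refine PtFlat.of_diag (hG i) fun i' hi' b => ?_
    rcases i' with _ | i''
    · simp [fieldCoefB_eq_zero hW0]
    · have hflat' : PtFlat i'' (vecDeriv (((Module.finBasis ℝ B) i, 0) : B × Z) h) z := by
        have := ((normalJetsVanishBelow_iff_ptFlat n h).1 hflat z).vecDeriv_inl ((Module.finBasis ℝ B) i)
        exact this.mono (by omega)
      rw [show (fun x => (fieldCoefB W i x : ℂ) * vecDeriv (((Module.finBasis ℝ B) i, 0) : B × Z) h x) =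
          (fun x => (fieldCoefB W i x : ℂ)) * vecDeriv (((Module.finBasis ℝ B) i, 0) : B × Z) h from rfl,
        vecWordDeriv_mul_of_ptFlat_of_eq_zero i'' hcs hGs (by simp [fieldCoefB_eq_zero hW0]) hflat' b,
        ← vecWordDeriv_append_singleton, show normalWord (List.replicate i'' b) ++ [(((Module.finBasis ℝ B) i, 0) : B × Z)] =
          normalWord (List.replicate i'' b ++ [(Module.finBasis ℝ B) i]) by rw [normalWord_append]; rfl,
        hflat _ (by simp; omega) z, mul_zero]
  · -- tangential terms
    have hcs : ContDiff ℝ ∞ fun x => (fieldCoefZ W k x : ℂ) := Complex.ofRealCLM.contDiff.comp (contDiff_fieldCoefZ hW k)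
    have hHs : ContDiff ℝ ∞ (vecDeriv (((0 : B), (Module.finBasis ℝ Z) k) : B × Z) h) := hh.vecDeriv' _
    have hHflat : PtFlat n (vecDeriv (((0 : B), (Module.finBasis ℝ Z) k) : B × Z) h) z :=
      (normalJetsVanishBelow_iff_ptFlat n _).1 (NormalJetsVanishBelow.vecDeriv_inr hh hflat _) z
    refine PtFlat.of_diag (hH k) fun i' hi' b => ?_
    rcases i' with _ | i''
    · simp [fieldCoefZ_eq_zero hW0]
    · rw [show (fun x => (fieldCoefZ W k x : ℂ) * vecDeriv (((0 : B), (Module.finBasis ℝ Z) k) : B × Z) h x) =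
          (fun x => (fieldCoefZ W k x : ℂ)) * vecDeriv (((0 : B), (Module.finBasis ℝ Z) k) : B × Z) h from rfl,
        vecWordDeriv_mul_of_ptFlat_of_eq_zero i'' hcs hHs (by simp [fieldCoefZ_eq_zero hW0]) (hHflat.mono (by omega)) b,
        hHflat _ (by simp; omega), mul_zero]

/-- **`fieldDerivC W h` is flat below `n`** if `h` is and `W` vanishes at the points of `{0} × Z` in the
support of `h`. [folklore] -/
theorem NormalJetsVanishBelow.fieldDerivC {W : B × Z → B × Z} (hW : ContDiff ℝ ∞ W) {h : B × Z → ℂ} (hh : ContDiff ℝ ∞ h)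
    {n : ℕ} (hflat : NormalJetsVanishBelow n h) (hW0 : ∀ z : Z, ((0 : B), z) ∈ tsupport h → W ((0 : B), z) = 0) :
    NormalJetsVanishBelow n (fieldDerivC W h) := by
  rw [normalJetsVanishBelow_iff_ptFlat]
  intro z
  by_cases hz : ((0 : B), z) ∈ tsupport h
  · exact ptFlat_fieldDerivC hW hh hflat (hW0 z hz)
  · exact ptFlat_of_notMem_tsupport (fun hm => hz (tsupport_fieldDerivC_subset W h hm)) n

/-- **The normal linearization** of a field at `(0, z)`: `b ↦ (DW(0,z)(b, 0)).1`. [folklore] -/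
def normalLinearization (W : B × Z → B × Z) (z : Z) : B →L[ℝ] B :=
  (ContinuousLinearMap.fst ℝ B Z).comp ((fderiv ℝ W ((0 : B), z)).comp (ContinuousLinearMap.inl ℝ B Z))

omit [FiniteDimensional ℝ B] [FiniteDimensional ℝ Z] in
/-- `normalLinearization W z b = (DW(0,z)(b,0)).1`. [folklore] -/
theorem normalLinearization_apply (W : B × Z → B × Z) (z : Z) (b : B) :
    normalLinearization W z b = (fderiv ℝ W ((0 : B), z) (b, 0)).1 := rfl

omit [FiniteDimensional ℝ Z] in
/-- The normal linearization in coordinates. [folklore] -/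
theorem normalLinearization_eq_sum {W : B × Z → B × Z} (hW : ContDiff ℝ ∞ W) (z : Z) (b : B) :
    normalLinearization W z b = ∑ i, fderiv ℝ (fieldCoefB W i) ((0 : B), z) (b, 0) • (Module.finBasis ℝ B) i := by
  set x₀ : B × Z := ((0 : B), z)
  have h1 : (fun x => (W x).1) = fun x => ∑ i, fieldCoefB W i x • (Module.finBasis ℝ B) i := by
    funext x; simp [fieldCoefB, (Module.finBasis ℝ B).sum_repr]
  have h2 : HasFDerivAt (fun x => (W x).1) ((ContinuousLinearMap.fst ℝ B Z).comp (fderiv ℝ W x₀)) x₀ :=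
    ((hW.differentiable (by simp)) x₀).hasFDerivAt.fst
  have h3 : HasFDerivAt (fun x => ∑ i, fieldCoefB W i x • (Module.finBasis ℝ B) i)
      (∑ i, (fderiv ℝ (fieldCoefB W i) x₀).smulRight ((Module.finBasis ℝ B) i)) x₀ :=
    HasFDerivAt.fun_sum fun i _ => (((contDiff_fieldCoefB hW i).differentiable (by simp)) x₀).hasFDerivAt.smul_const _
  rw [h1] at h2
  have h4 := h2.unique h3
  rw [normalLinearization_apply, show fderiv ℝ W ((0 : B), z) (b, 0) = fderiv ℝ W x₀ (b, 0) from rfl]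
  have h5 := congrArg (fun T : B × Z →L[ℝ] B => T ((b, 0) : B × Z)) h4
  simp only [ContinuousLinearMap.coe_comp, Function.comp_apply, ContinuousLinearMap.coe_fst'] at h5
  rw [h5, sum_apply]
  rfl

/-- **Top normal jet of `fieldDerivC W h` on the diagonal**: for `h` flat below `n + 1` and `W(0,z) = 0`,
`∂_{(b)^{n+1}} (W h)(0,z) = (n+1) · J_{n+1}h (z)(b, …, b, L_z b)`. [cite: HormanderALPDO1, Thm. 2.3.5, §3.1] -/
theorem normalJet_fieldDerivC_apply_const {W : B × Z → B × Z} (hW : ContDiff ℝ ∞ W) {h : B × Z → ℂ} (hh : ContDiff ℝ ∞ h)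
    {n : ℕ} (hflat : NormalJetsVanishBelow (n + 1) h) {z : Z} (hW0 : W ((0 : B), z) = 0) (b : B) :
    normalJet (n + 1) (fieldDerivC W h) z (fun _ => b) =
      ((n + 1 : ℕ) : ℂ) * normalJet (n + 1) h z (update (fun _ => b) (Fin.last n) (normalLinearization W z b)) := by
  have hG : ∀ i, ContDiff ℝ ∞ fun x => (fieldCoefB W i x : ℂ) * vecDeriv (((Module.finBasis ℝ B) i, 0) : B × Z) h x :=
    fun i => (Complex.ofRealCLM.contDiff.comp (contDiff_fieldCoefB hW i)).mul (hh.vecDeriv' _)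
  have hH : ∀ k, ContDiff ℝ ∞ fun x => (fieldCoefZ W k x : ℂ) * vecDeriv (((0 : B), (Module.finBasis ℝ Z) k) : B × Z) h x :=
    fun k => (Complex.ofRealCLM.contDiff.comp (contDiff_fieldCoefZ hW k)).mul (hh.vecDeriv' _)
  have hsumG : ContDiff ℝ ∞ (∑ i, fun x => (fieldCoefB W i x : ℂ) * vecDeriv (((Module.finBasis ℝ B) i, 0) : B × Z) h x) := by
    rw [Finset.sum_fn]; exact ContDiff.sum fun i _ => hG i
  have hsumH : ContDiff ℝ ∞ (∑ k, fun x => (fieldCoefZ W k x : ℂ) * vecDeriv (((0 : B), (Module.finBasis ℝ Z) k) : B × Z) h x) := by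
    rw [Finset.sum_fn]; exact ContDiff.sum fun k _ => hH k
  have hpt : PtFlat (n + 1) h z := (normalJetsVanishBelow_iff_ptFlat _ h).1 hflat z
  -- each normal term
  have hGterm : ∀ i, vecWordDeriv (normalWord (List.replicate (n + 1) b))
      (fun x => (fieldCoefB W i x : ℂ) * vecDeriv (((Module.finBasis ℝ B) i, 0) : B × Z) h x) ((0 : B), z) =
      ((n + 1 : ℕ) : ℂ) * ((fderiv ℝ (fieldCoefB W i) ((0 : B), z) (b, 0) : ℝ) : ℂ) *
        normalJet (n + 1) h z (update (fun _ => b) (Fin.last n) ((Module.finBasis ℝ B) i)) := by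
    intro i
    have hcs : ContDiff ℝ ∞ fun x => (fieldCoefB W i x : ℂ) := Complex.ofRealCLM.contDiff.comp (contDiff_fieldCoefB hW i)
    have hGs : ContDiff ℝ ∞ (vecDeriv (((Module.finBasis ℝ B) i, 0) : B × Z) h) := hh.vecDeriv' _
    have hflat' : PtFlat n (vecDeriv (((Module.finBasis ℝ B) i, 0) : B × Z) h) z := by
      simpa using hpt.vecDeriv_inl ((Module.finBasis ℝ B) i)
    rw [show (fun x => (fieldCoefB W i x : ℂ) * vecDeriv (((Module.finBasis ℝ B) i, 0) : B × Z) h x) =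
        (fun x => (fieldCoefB W i x : ℂ)) * vecDeriv (((Module.finBasis ℝ B) i, 0) : B × Z) h from rfl,
      vecWordDeriv_mul_of_ptFlat_of_eq_zero n hcs hGs (by simp [fieldCoefB_eq_zero hW0]) hflat' b,
      vecDeriv_ofReal_comp ((contDiff_fieldCoefB hW i).differentiable (by simp)),
      ← vecWordDeriv_append_singleton, show normalWord (List.replicate n b) ++ [(((Module.finBasis ℝ B) i, 0) : B × Z)] =
        normalWord (List.replicate n b ++ [(Module.finBasis ℝ B) i]) by rw [normalWord_append]; rfl,
      ← vecWordDeriv_normalWord_ofFn_eq_normalJet hh]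
    congr 2
    rw [List.ofFn_succ', List.concat_eq_append, update_self,
      show (fun i' : Fin n => update (fun _ : Fin (n + 1) => b) (Fin.last n) ((Module.finBasis ℝ B) i) i'.castSucc) =
        fun _ => b from funext fun i' => update_of_ne (Fin.castSucc_lt_last i').ne _ _, List.ofFn_const]
  -- each tangential term vanishes
  have hHterm : ∀ k, vecWordDeriv (normalWord (List.replicate (n + 1) b))
      (fun x => (fieldCoefZ W k x : ℂ) * vecDeriv (((0 : B), (Module.finBasis ℝ Z) k) : B × Z) h x) ((0 : B), z) = 0 := by
    intro k
    have hcs : ContDiff ℝ ∞ fun x => (fieldCoefZ W k x : ℂ) := Complex.ofRealCLM.contDiff.comp (contDiff_fieldCoefZ hW k)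
    have hHs : ContDiff ℝ ∞ (vecDeriv (((0 : B), (Module.finBasis ℝ Z) k) : B × Z) h) := hh.vecDeriv' _
    have hHflat : PtFlat (n + 1) (vecDeriv (((0 : B), (Module.finBasis ℝ Z) k) : B × Z) h) z :=
      (normalJetsVanishBelow_iff_ptFlat _ _).1 (NormalJetsVanishBelow.vecDeriv_inr hh hflat _) z
    rw [show (fun x => (fieldCoefZ W k x : ℂ) * vecDeriv (((0 : B), (Module.finBasis ℝ Z) k) : B × Z) h x) =
        (fun x => (fieldCoefZ W k x : ℂ)) * vecDeriv (((0 : B), (Module.finBasis ℝ Z) k) : B × Z) h from rfl,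
      vecWordDeriv_mul_of_ptFlat_of_eq_zero n hcs hHs (by simp [fieldCoefZ_eq_zero hW0]) (hHflat.mono (Nat.le_succ n)) b,
      hHflat _ (by simp), mul_zero]
  rw [normalJet_apply_const (contDiff_fieldDerivC hW hh), fieldDerivC_eq_sum, vecWordDeriv_add' hsumG hsumH, Pi.add_apply,
    vecWordDeriv_finset_sum _ (fun i _ => hG i), vecWordDeriv_finset_sum _ (fun k _ => hH k), Finset.sum_apply,
    Finset.sum_apply]
  simp_rw [hGterm, hHterm]
  rw [Finset.sum_const_zero, add_zero, normalLinearization_eq_sum hW]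
  -- multilinearity in the last slot
  set m := normalJet (n + 1) h z
  set c : Fin (n + 1) → B := fun _ => b
  have hlin : ∀ y : B, m (update c (Fin.last n) y) = (m.toContinuousLinearMap c (Fin.last n)) y := fun y => by
    simp
  have hm : m (update c (Fin.last n) (∑ i, fderiv ℝ (fieldCoefB W i) ((0 : B), z) (b, 0) • (Module.finBasis ℝ B) i)) =
      ∑ i, ((fderiv ℝ (fieldCoefB W i) ((0 : B), z) (b, 0) : ℝ) : ℂ) * m (update c (Fin.last n) ((Module.finBasis ℝ B) i)) := by
    rw [hlin, map_sum]
    refine Finset.sum_congr rfl fun i _ => ?_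
    rw [map_smul, hlin, Complex.real_smul]
  rw [hm, Finset.mul_sum]
  refine Finset.sum_congr rfl fun i _ => ?_
  ring

/-- **Top normal jet of `fieldDerivC W h`**: for `h` flat below `n` and `W(0,z) = 0`,
`J_n(W h)(z) = slotDeriv (L_z) (J_n h (z))`, `L_z = normalLinearization W z`.
[cite: HormanderALPDO1, Thm. 2.3.5, §3.1] -/
theorem normalJet_fieldDerivC {W : B × Z → B × Z} (hW : ContDiff ℝ ∞ W) {h : B × Z → ℂ} (hh : ContDiff ℝ ∞ h)
    {n : ℕ} (hflat : NormalJetsVanishBelow n h) {z : Z} (hW0 : W ((0 : B), z) = 0) :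
    normalJet n (fieldDerivC W h) z = slotDeriv (normalLinearization W z) (normalJet n h z) := by
  cases n with
  | zero =>
    ext v
    rw [slotDeriv_apply, Finset.univ_eq_empty, Finset.sum_empty, normalJet_apply, iteratedFDeriv_zero_apply, fieldDerivC,
      hW0, map_zero]
  | succ n =>
    refine eq_of_forall_diag_eq (fun v σ => normalJet_comp_perm (contDiff_fieldDerivC hW hh) z v σ)
      (slotDeriv_comp_perm _ fun v σ => normalJet_comp_perm hh z v σ) fun b => ?_
    rw [normalJet_fieldDerivC_apply_const hW hh hflat hW0 b, slotDeriv_apply_const _ fun v σ => normalJet_comp_perm hh z v σ]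

end FieldJet


end Literature.Analysis.Distribution
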